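import Summits.AtomisticToContinuum.Crystallization.Theorems.FrustratedLawDichotomyStrainedPatchHomEntryLeafHTA2QCellG72EV1

/-!
# v3 T0 CELL `cG72E × wG72E` (0.725 t_b, EIGHT-coarse: 2⁻¹⁰ on (0,0), 2⁻⁹ else (k₆ = 5)), part 2: the p-dependent kernel facts `restG72EV` and `linG72EV` (sharp linear pieces)
# (27623 `(H) HomFloor (1/625)`, hcp half; hand-1 g38; T0 cell under critic row 1437 (E) «T0 ≤ 500 core-h RELEASED (anchors + ≤ 40 cells)»; payloads from hand-1 g37 probes `G72P8` a/b/c + hand-1 g38 probe `M38` (kernel-exact `rem3LJS`))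

Kernel facts; 0 sorry; standard axioms.  `--supports stmt-AtomisticToContinuum-27623`.
-/

namespace Summit.AtomisticToContinuum.Crystallization.Theorems.FrustratedLawDichotomyStrainedPatchHomEntryLeafHT

open Literature.Analysis.ValidatedNumerics.Numerics
open Summit.AtomisticToContinuum.Crystallization.Theorems.FrustratedLawDichotomyStrainedPatchHomCertTree (CertTree treeOK)
open Summit.AtomisticToContinuum.Crystallization.Theorems.FrustratedLawDichotomyStrainedPatchHomEntryTable (muRec)
open Summit.AtomisticToContinuum.Crystallization.Theorems.FrustratedLawDichotomyStrainedPatchHomEntryFitHcpCentred (entryLeafOKHQDCRS)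
open Summit.AtomisticToContinuum.Crystallization.Theorems.FrustratedLawDichotomyStrainedPatchHomSlopeLJ
open Summit.AtomisticToContinuum.Crystallization.Theorems.FrustratedLawDichotomyStrainedPatchHomSlopeLJAffine
open Summit.AtomisticToContinuum.Crystallization.Theorems.FrustratedLawDichotomyStrainedPatchHomSlopeLJAffine2Kit
open Summit.AtomisticToContinuum.Crystallization.Theorems.FrustratedLawDichotomyStrainedPatchHomSlopeLJAffine2KitS (rem3LJS)

set_option maxRecDepth 100000 in
set_option maxHeartbeats 4000000 in
/-- ★ KERNEL: the non-slope conjuncts of the certificate side for `pG72EV`. -/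
theorem restG72EV : htCertRestA2 pG72EV JG72E cG72E wG72E = true := by
  decide +kernel

set_option maxRecDepth 100000 in
set_option maxHeartbeats 4000000 in
/-- ★ KERNEL: `g₀ + lin + ⌈√ΣQ²⌉ + rem3♯ + nai = 811971128676 ≤ GnG72EV` (sharp third-order remainder `rem3LJS`). -/
theorem linG72EV : g0LJ cG72E (htScA2F cG72E wG72E JG72E (htNearU cG72E wG72E)) + linLJA cG72E wG72E JG72E (htScA2F cG72E wG72E JG72E (htNearU cG72E wG72E)) + sqrtQ QG72E +
    rem3LJS cG72E wG72E JG72E (htScA2F cG72E wG72E JG72E (htNearU cG72E wG72E)) + naiSLJ cG72E (hullW JG72E wG72E) (htSnA2F cG72E wG72E JG72E (htNearU cG72E wG72E)) ≤ GnG72EV := by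
  decide +kernel

end Summit.AtomisticToContinuum.Crystallization.Theorems.FrustratedLawDichotomyStrainedPatchHomEntryLeafHT
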